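import Summits.AtomisticToContinuum.Crystallization.Theorems.ChargedEnergyGapBarlowResidual
import HarnessLib

/-!
# Charged energy gap — lens-3 g66, node «AffineChart» (part 29a): the affine sub-family of (H𝄪ᴮ), the sitewise affine-stability input,
and the cocycle chart

Line of record `stmt-AtomisticToContinuum-14231` (record cone `chargedEnergyGap_of_maxCoverLocalLedgerB_record`, §R3 of
`ChargedEnergyGapBarlowRef`).  Node 64/65 left the residual of record as `(H𝄪ᴮ) = LocalSeamTransferBoundB` at the record dials with its
ROTATION sub-family `RotationFamilyB` closed (g65, `rotationFamilyB_record`, from `BulkFarResidueBoundB` at `(B_T, B_χ) = (1/2100, 1/46)`).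

NODE 65 «AffineChart» types what lies beyond the rotations inside (H𝄪ᴮ):

* §A the AFFINE field `affineField A : (y, z) ↦ A (z − y)` of a linear map `A : E3 →ₗ[ℝ] E3` (a global cocycle; the rotations are the
  skew `A = rotLin r₀ v`);
* §B the AFFINE SUB-FAMILY `AffineFamilyB` of (H𝄪ᴮ) (`β₀ := affineField A`, `k := 0`): WEAKER than (H𝄪ᴮ) (`affineFamilyB_of_localB`) and
  containing the rotation sub-family (`rotationFamilyB_of_affineFamilyB`);
* §C the reference-class input SITEWISE AFFINE STABILITY `SitewiseAffineStabilityB s lam ℓ μ₀ κ`: at every motif site of an admissible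
  reference, the UNEXCISED quadratic site form of an affine field dominates `κ·⟪u, A u⟫²` for every unit vector `u` (only the symmetric part
  of `A` is charged: the skew part has zero site energy at a site-stress-free site, `quadSite_rotField_eq_zero`); and its LOCAL,
  classification-free form `SitewiseAffineStabilityLoc s κ` (Barlow datum + the local site virial only; `SitewiseAffineStabilityLoc.toB`);
* §D the COCYCLE CHART (the lens-3 EQUIV of this node): every global cocycle of a periodic reference is, ON THE REFERENCE POINTS, an affine
  field plus the cocycle of a lattice-periodic displacement field (`exists_affine_add_periodic_of_isGlobalCocycle`), and conversely such
  fields are global cocycles (`isGlobalCocycle_affine_add_fieldCocycle`); the chart is UNIQUE (`affine_part_unique`: `A`;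
  `periodic_part_unique`: `p` up to one additive constant on the reference points); the model functional and the strain hypothesis only read
  `β` on the reference points (`modelFarL_congr_points`, `smallStrain_congr_points`).  The linear map is produced from the structure fields
  `P.lattice` / `P.discrete` / `P.isZLattice` via Mathlib's `ZLattice.module_free`, `Module.Free.chooseBasis`, `Module.Basis.ofZLatticeBasis`.

Part 29b (`ChargedEnergyGapAffineCharging`) proves the affine sub-family at the record dials from `SitewiseAffineStabilityB` and
`BulkFarResidueBoundB` by a SITEWISE COMPLETION OF THE SQUARE against the sharp far tail.  0 sorry; standard axioms.
-/

noncomputable section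

open scoped Classical
open Literature.MathematicalPhysics.StatisticalMechanics Literature.Geometry.DiscreteGeometry
open Summit.AtomisticToContinuum.Crystallization.Theses.PricedLinkCensus
open Summit.AtomisticToContinuum.Crystallization.Theorems.ChargedEnergyGapNegative

namespace Summit.AtomisticToContinuum.Crystallization.Theorems.ChargedEnergyGapChartDial

/-! ## §A  Affine fields -/
section Affine

/-- The **AFFINE FIELD** of a linear map `A`: the bond field `(y, z) ↦ A (z − y)` (homogeneous strain-rotation `A = S + W`). -/
def affineField (A : E3 →ₗ[ℝ] E3) : E3 → E3 → E3 :=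
  fun y z => A (z - y)

/-- `affineField_apply` (docstring added by the landing lane; see the module docstring). [formal bookkeeping] -/
@[simp] theorem affineField_apply (A : E3 →ₗ[ℝ] E3) (y z : E3) : affineField A y z = A (z - y) := rfl

/-- An affine field is a global cocycle of every periodic reference. -/
theorem isGlobalCocycle_affineField (P : PeriodicConfiguration 3) (A : E3 →ₗ[ℝ] E3) : IsGlobalCocycle P (affineField A) := by
  refine ⟨fun y _ z _ => ?_, fun g _ y z => ?_, fun y _ z _ x _ => ?_⟩
  · simp only [affineField_apply, ← map_neg, neg_sub]
  · simp only [affineField_apply, add_sub_add_right_eq_sub]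
  · simp only [affineField_apply, ← map_add]
    congr 1
    abel

/-- The linear map `x ↦ ⟪x, r₀⟫ v − ⟪x, v⟫ r₀` of the infinitesimal rotation `W_{r₀,v}`. -/
def rotLin (r₀ v : E3) : E3 →ₗ[ℝ] E3 where
  toFun x := inner ℝ x r₀ • v - inner ℝ x v • r₀
  map_add' x y := by
    simp only [inner_add_left, add_smul]
    abel
  map_smul' c x := by
    simp only [real_inner_smul_left, RingHom.id_apply, smul_sub, mul_smul]

/-- `rotLin_apply` (docstring added by the landing lane; see the module docstring). [formal bookkeeping] -/
@[simp] theorem rotLin_apply (r₀ v x : E3) : rotLin r₀ v x = inner ℝ x r₀ • v - inner ℝ x v • r₀ := rfl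

/-- The rotation field IS the affine field of `rotLin r₀ v`. -/
theorem affineField_rotLin (r₀ v : E3) : affineField (rotLin r₀ v) = rotField r₀ v := by
  funext y z
  rfl

/-- Affine fields are translation invariant in the base point: `affineField A y (y + x) = A x`. -/
theorem affineField_add_right (A : E3 →ₗ[ℝ] E3) (y x : E3) : affineField A y (y + x) = A x := by
  simp [affineField_apply]

end Affine

/-! ## §B  The affine sub-family of (H𝄪ᴮ) -/
section AffineFamily

variable (s lam ℓ μ₀ τ lamQ ϱ b₀ r_S C_T ϱχ Cχ : ℝ)

/-- piece AFFINE-FAMILYᴮ · WEAKER than (H𝄪ᴮ) (its specialisation `β₀ := affineField A`, `k := 0`) · UNDECIDED→TRUE-leaning at the record dials ·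
ATTACKABLE·M (part 29b closes it from `SitewiseAffineStabilityB` + `BulkFarResidueBoundB`): the seam-free AFFINE instances of (H𝄪ᴮ) — homogeneous
strain-rotations `A = S + W` of the admissible reference, with the strain hypothesis forcing `‖A‖ ≤ τ`.  It contains the rotation sub-family
(`rotationFamilyB_of_affineFamilyB`); what it adds is the SYMMETRIC part `S`, whose excised linear site term is FIRST ORDER in `S`. -/
def AffineFamilyB : Prop :=
  ∃ C_H : ℝ, 0 ≤ C_H ∧ ∀ (P : PeriodicConfiguration 3) (C X : Set E3) (A : E3 →ₗ[ℝ] E3) (S : Fin 0 → CutPiece) (m : ℕ)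
    (D : Fin m → Set E3) (σ : Fin m → Bool),
    IsSeparatedRef s P → IsLabelledRef lam ℓ P → IsBarlowImage P.points → IsForceFree P → IsSiteStressFree P → HarmStableModRot μ₀ P →
    IsInvariantSet P C → IsInvariantSet P X → IsGlobalCocycle P (affineField A) → IsSeamSystem b₀ r_S P S →
    SmallStrain τ P X (volterraField P S (affineField A)) → (∀ i, IsInvariantSet P (D i)) →
    -(C_T * shellMassL ϱχ D σ P X ϱ C) - Cχ * transMassL ϱχ D σ P X ϱ C - C_H * (pricedNearCountL ϱχ D σ P X ϱ C : ℝ) ≤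
      modelFarL ϱχ D σ (volterraField P S (affineField A)) P X lamQ ϱ C

variable {s lam ℓ μ₀ τ lamQ ϱ b₀ r_S C_T ϱχ Cχ}

/-- (H𝄪ᴮ) ⟹ its affine sub-family (specialisation `β₀ := affineField A`, `k := 0`): the piece is WEAKER. -/
theorem affineFamilyB_of_localB (h : LocalSeamTransferBoundB s lam ℓ μ₀ τ lamQ ϱ b₀ r_S C_T ϱχ Cχ) :
    AffineFamilyB s lam ℓ μ₀ τ lamQ ϱ b₀ r_S C_T ϱχ Cχ := by
  obtain ⟨C_H, hC, hall⟩ := h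
  exact ⟨C_H, hC, fun P C X A S m D σ => hall P C X (affineField A) 0 S m D σ⟩

/-- The affine sub-family contains the rotation sub-family (`rotField r₀ v = affineField (rotLin r₀ v)`). -/
theorem rotationFamilyB_of_affineFamilyB (h : AffineFamilyB s lam ℓ μ₀ τ lamQ ϱ b₀ r_S C_T ϱχ Cχ) :
    RotationFamilyB s lam ℓ μ₀ τ lamQ ϱ b₀ r_S C_T ϱχ Cχ := by
  obtain ⟨C_H, hC, hall⟩ := h
  refine ⟨C_H, hC, fun P C X r₀ v S m D σ => ?_⟩
  have h1 := hall P C X (rotLin r₀ v) S m D σ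
  rw [affineField_rotLin] at h1
  exact h1

end AffineFamily

/-! ## §C  The reference-class input: sitewise affine stability -/
section SitewiseStability

variable (s lam ℓ μ₀ : ℝ)

/-- piece SITEWISE-AFFINE-STABILITYᴮ(`κ`) · a reference-class input (like `HarmStableModRot`) · UNDECIDED→TRUE-leaning for the Barlow references at
moderate `κ` (fcc at the LJ lattice constant: the softest shear has `q_y(affineField S) ≈ 1.8·‖S‖_F² ≥ 1.8·⟪u, S u⟫²`, so `κ = 1/10` leaves a
margin ≈ 18; part 29b needs `κ ≥ 1/10` at the record dials) · INSTRUMENTABLE (interval lattice sums, `StabilityNumerics`) · ATTACKABLE·S per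
reference: at EVERY motif site `y` of an admissible reference and for EVERY linear `A`, the UNEXCISED quadratic site form of the affine field
dominates `κ·⟪u, A u⟫²` for all unit `u` — i.e. `κ·(numerical radius of the symmetric part)²`.  Only the symmetric part can be charged: at a
site-stress-free site the skew part has zero site form (`quadSite_rotField_eq_zero`) and drops out of `q_y(affineField A)` altogether.
Why it might fail: a Barlow stacking with a soft internal shear mode at some motif site (hcp-type stackings are NOT centrosymmetric sitewise);
the statement is per site, not per motif average (`HarmStableModRot` only gives the average). -/
def SitewiseAffineStabilityB (κ : ℝ) : Prop :=
  ∀ (P : PeriodicConfiguration 3), IsSeparatedRef s P → IsLabelledRef lam ℓ P → IsBarlowImage P.points → IsForceFree P →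
    IsSiteStressFree P → HarmStableModRot μ₀ P →
    ∀ y ∈ P.motif, ∀ (A : E3 →ₗ[ℝ] E3) (u : E3), ‖u‖ = 1 → κ * inner ℝ u (A u) ^ 2 ≤ quadSite (affineField A) P ∅ y

variable {s lam ℓ μ₀}

/-- Sitewise affine stability is monotone in `κ` (a smaller constant is a weaker demand). -/
theorem SitewiseAffineStabilityB.mono {κ κ' : ℝ} (hκ : κ' ≤ κ) (h : SitewiseAffineStabilityB s lam ℓ μ₀ κ) :
    SitewiseAffineStabilityB s lam ℓ μ₀ κ' :=
  fun P h1 h2 h3 h4 h5 h6 y hy A u hu =>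
    (mul_le_mul_of_nonneg_right hκ (sq_nonneg _)).trans (h P h1 h2 h3 h4 h5 h6 y hy A u hu)

/-- **[A-i, LOCAL FORM — the instrument's statement]** (critic row 1263 (2): classification-free).  Only the Barlow datum of the binder
(`IsBarlowImage P.points`: the point set is a rigid image of an explicit stacking `barlowStacking a h s`, `(a, h)` in the window, any Hägg word
`s`) and the LOCAL site virial AT THE SITE are assumed — no force-freeness, no global stress-freeness, no harmonic stability, no labelling:
`siteVirial_y = 0 ⟹ κ·⟪u, A u⟫² ≤ q^∅_y(A)`.  (Without the local virial hypothesis the statement is FALSE on the window: at `a = 11/10` the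
nearest-neighbour weight `(V″ − V′/d)d²/4` is negative.)  Its instrument is finite: local stacking words to the tail depth × an interval box in
`(a, h)`, discarding boxes with certified non-zero site virial. -/
def SitewiseAffineStabilityLoc (s κ : ℝ) : Prop :=
  ∀ (P : PeriodicConfiguration 3), IsSeparatedRef s P → IsBarlowImage P.points →
    ∀ y ∈ P.motif, (∀ a b : E3, siteVirial P y a b = 0) →
      ∀ (A : E3 →ₗ[ℝ] E3) (u : E3), ‖u‖ = 1 → κ * inner ℝ u (A u) ^ 2 ≤ quadSite (affineField A) P ∅ y

/-- The local form implies the class form consumed by the glue (the class is site-stress-free). -/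
theorem SitewiseAffineStabilityLoc.toB {s lam ℓ μ₀ κ : ℝ} (h : SitewiseAffineStabilityLoc s κ) :
    SitewiseAffineStabilityB s lam ℓ μ₀ κ :=
  fun P hsep _ hb _ hS _ y hy A u hu => h P hsep hb y hy (hS y hy) A u hu

end SitewiseStability

/-! ## §D  ★★ The cocycle chart (the lens-3 EQUIV): global cocycles on the reference = affine ⊕ periodic-field cocycles -/
section CocycleChart

variable {P : PeriodicConfiguration 3}

/-- The lattice part of a global cocycle does not depend on the base point: `β q (q + g) = β y₀ (y₀ + g)` for `q, y₀ ∈ F+Λ`, `g ∈ Λ_P`. -/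
theorem cocycle_base_shift {β : E3 → E3 → E3} (hβ : IsGlobalCocycle P β) {y₀ q : E3} (hy₀ : y₀ ∈ P.points) (hq : q ∈ P.points)
    {g : E3} (hg : g ∈ P.lattice) : β q (q + g) = β y₀ (y₀ + g) := by
  obtain ⟨hanti, hinv, hcoc⟩ := hβ
  have hqg : q + g ∈ P.points := P.add_mem_points hq hg
  have hy₀g : y₀ + g ∈ P.points := P.add_mem_points hy₀ hg
  have h1 : β q (q + g) = β q y₀ + β y₀ (q + g) := (hcoc q hq y₀ hy₀ (q + g) hqg).symm
  have h2 : β y₀ (q + g) = β y₀ (y₀ + g) + β (y₀ + g) (q + g) := (hcoc y₀ hy₀ (y₀ + g) hy₀g (q + g) hqg).symm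
  have h3 : β (y₀ + g) (q + g) = β y₀ q := hinv g hg y₀ q
  have h4 : β q y₀ = -β y₀ q := hanti y₀ hy₀ q hq
  rw [h1, h2, h3, h4]
  abel

/-- Linear displacements are equivariant (difference `A g`). -/
theorem isEquivariantField_linear (A : E3 →ₗ[ℝ] E3) : IsEquivariantField P fun q => A q :=
  fun g _ q q' => by simp only [map_add]; abel

variable (P) in
/-- ★ **EXTENSION FROM THE LATTICE**: an additive map on the lattice of periods extends to a linear map of `ℝ³` (a `ℤ`-basis of the full-rank
lattice `Λ_P` is an `ℝ`-basis of `ℝ³`, Mathlib `Module.Basis.ofZLatticeBasis`). -/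
theorem exists_linearMap_extend (a : P.lattice →+ E3) : ∃ A : E3 →ₗ[ℝ] E3, ∀ g : P.lattice, A (g : E3) = a g := by
  haveI := P.discrete
  haveI := P.isZLattice
  haveI : Module.Free ℤ P.lattice := ZLattice.module_free ℝ P.lattice
  let b := Module.Free.chooseBasis ℤ P.lattice
  let B : Module.Basis _ ℝ E3 := b.ofZLatticeBasis ℝ P.lattice
  refine ⟨B.constr ℝ fun i => a (b i), fun g => ?_⟩
  have hAB : ∀ i, B.constr ℝ (fun i => a (b i)) (b i : E3) = a (b i) := fun i => by
    have := B.constr_basis ℝ (fun i => a (b i)) i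
    rwa [Module.Basis.ofZLatticeBasis_apply] at this
  have key : ((B.constr ℝ fun i => a (b i)).restrictScalars ℤ).comp P.lattice.subtype = a.toIntLinearMap :=
    b.ext fun i => by
      simp only [LinearMap.coe_comp, Function.comp_apply, Submodule.coe_subtype, LinearMap.coe_restrictScalars,
        AddMonoidHom.coe_toIntLinearMap]
      exact hAB i
  have := LinearMap.congr_fun key g
  simpa using this

/-- ★★ **CHART OF EQUIVARIANT DISPLACEMENTS**: `u = A + p` with `A` linear and `p` `Λ_P`-periodic, everywhere on `ℝ³`. -/
theorem exists_linear_add_periodic_of_isEquivariantField {u : E3 → E3} (hu : IsEquivariantField P u) :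
    ∃ (A : E3 →ₗ[ℝ] E3) (p : E3 → E3), IsPeriodicField P p ∧ ∀ q, u q = A q + p q := by
  let a : P.lattice →+ E3 :=
    { toFun := fun g => u (g : E3) - u 0
      map_zero' := by simp
      map_add' := fun g g' => by
        have h := hu (g' : E3) g'.2 (g : E3) 0
        rw [zero_add, sub_eq_iff_eq_add] at h
        simp only [Submodule.coe_add]
        rw [h]
        abel }
  obtain ⟨A, hA⟩ := exists_linearMap_extend P a
  refine ⟨A, fun q => u q - A q, fun g hg q => ?_, fun q => by beta_reduce; abel⟩
  have h := hu g hg q 0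
  have hAg : A g = u g - u 0 := hA ⟨g, hg⟩
  rw [zero_add, sub_eq_iff_eq_add] at h
  beta_reduce
  rw [map_add, hAg, h]
  abel

/-- ★★ **THE COCYCLE CHART (lens-3 EQUIV).**  A global cocycle on the reference is, ON THE REFERENCE POINTS, an affine field plus a
periodic-field cocycle: `β y z = A(z − y) + (p z − p y)` for `y, z ∈ F+Λ`, `A` linear, `p` `Λ_P`-periodic (equivalently: the bond field of the
equivariant displacement `A + p`).  Conversely every such field is a global cocycle (`isGlobalCocycle_affineField`,
`isGlobalCocycle_fieldCocycle`); the values of `β` off the reference are not determined (so a literal `↔` on all of `ℝ³ × ℝ³` is false), but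
they never enter the model functional.  CONSEQUENCE FOR THE NODE: the instances of `(H𝄪ᴮ)` are charted by `(A, p, seams)`; `AffineFamilyB`
is the slice `p = const, k = 0`. -/
theorem exists_affine_add_periodic_of_isGlobalCocycle {β : E3 → E3 → E3} (hβ : IsGlobalCocycle P β) :
    ∃ (A : E3 →ₗ[ℝ] E3) (p : E3 → E3), IsPeriodicField P p ∧
      ∀ y ∈ P.points, ∀ z ∈ P.points, β y z = affineField A y z + fieldCocycle p y z := by
  obtain ⟨y₀, hy₀⟩ := P.points_nonempty
  have hβ' := hβ
  obtain ⟨hanti, hinv, hcoc⟩ := hβ'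
  have h00 : β y₀ y₀ = 0 := by
    have h := hanti y₀ hy₀ y₀ hy₀
    have h2 : (2 : ℝ) • β y₀ y₀ = 0 := by
      rw [two_smul]
      nth_rewrite 2 [h]
      exact add_neg_cancel _
    exact (smul_eq_zero.1 h2).resolve_left two_ne_zero
  let a : P.lattice →+ E3 :=
    { toFun := fun g => β y₀ (y₀ + g)
      map_zero' := by simpa using h00
      map_add' := fun g g' => by
        have hg' : y₀ + (g : E3) ∈ P.points := P.add_mem_points hy₀ g.2
        have e1 : β y₀ (y₀ + ((g : E3) + (g' : E3))) = β y₀ (y₀ + g) + β (y₀ + g) (y₀ + ((g : E3) + (g' : E3))) :=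
          (hcoc y₀ hy₀ (y₀ + g) hg' _ (P.add_mem_points hy₀ (P.lattice.add_mem g.2 g'.2))).symm
        have e2 : β (y₀ + g) (y₀ + ((g : E3) + (g' : E3))) = β y₀ (y₀ + g') := by
          rw [← add_assoc]
          exact cocycle_base_shift hβ hy₀ hg' g'.2
        simp only [Submodule.coe_add]
        rw [e1, e2] }
  obtain ⟨A, hA⟩ := exists_linearMap_extend P a
  have hAg : ∀ g ∈ P.lattice, A g = β y₀ (y₀ + g) := fun g hg => hA ⟨g, hg⟩
  refine ⟨A, fun q => if q ∈ P.points then β y₀ q - A (q - y₀) else 0, fun g hg q => ?_, fun y hy z hz => ?_⟩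
  · beta_reduce
    by_cases hq : q ∈ P.points
    · have hqg : q + g ∈ P.points := P.add_mem_points hq hg
      rw [if_pos hqg, if_pos hq]
      have e1 : β y₀ (q + g) = β y₀ q + β q (q + g) := (hcoc y₀ hy₀ q hq (q + g) hqg).symm
      have e2 : β q (q + g) = A g := by rw [cocycle_base_shift hβ hy₀ hq hg, hAg g hg]
      rw [e1, e2, show q + g - y₀ = (q - y₀) + g from by abel, map_add]
      abel
    · have hqg : q + g ∉ P.points := fun h => hq (by simpa using P.add_mem_points h (P.lattice.neg_mem hg))
      rw [if_neg hqg, if_neg hq]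
  · simp only [affineField_apply, fieldCocycle, if_pos hy, if_pos hz]
    have e1 : β y z = β y y₀ + β y₀ z := (hcoc y hy y₀ hy₀ z hz).symm
    have e2 : β y y₀ = -β y₀ y := hanti y₀ hy₀ y hy
    rw [e1, e2, show z - y = (z - y₀) - (y - y₀) from by abel, map_sub]
    abel

/-- … packaged as an EQUIVARIANT DISPLACEMENT: `β = δu` on the reference points with `u = A + p` equivariant. -/
theorem exists_equivariant_of_isGlobalCocycle {β : E3 → E3 → E3} (hβ : IsGlobalCocycle P β) :
    ∃ u : E3 → E3, IsEquivariantField P u ∧ ∀ y ∈ P.points, ∀ z ∈ P.points, β y z = fieldCocycle u y z := by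
  obtain ⟨A, p, hp, h⟩ := exists_affine_add_periodic_of_isGlobalCocycle hβ
  refine ⟨fun q => A q + p q, (isEquivariantField_linear A).add hp.isEquivariantField, fun y hy z hz => ?_⟩
  rw [h y hy z hz]
  simp only [affineField_apply, fieldCocycle, map_sub]
  abel

/-- The model functional only reads the bond field ON THE REFERENCE POINTS: two fields agreeing there have the same `modelFarL`. -/
theorem modelFarL_congr_points (ϱχ : ℝ) {m : ℕ} (D : Fin m → Set E3) (σ : Fin m → Bool) (X : Set E3) (lamQ ϱ : ℝ) (C : Set E3)
    {β β' : E3 → E3 → E3} (h : ∀ y ∈ P.points, ∀ z ∈ P.points, β y z = β' y z) :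
    modelFarL ϱχ D σ β P X lamQ ϱ C = modelFarL ϱχ D σ β' P X lamQ ϱ C := by
  unfold modelFarL
  refine Finset.sum_congr rfl fun y hy => ?_
  have hyP : y ∈ P.points := P.mem_points_of_mem_motif hy
  have hl : linSite β P X y = linSite β' P X y := by
    unfold linSite
    congr 1
    exact tsum_congr fun z => by unfold bondLin; rw [h y hyP z z.2.1]
  have hq : quadSite β P X y = quadSite β' P X y := by
    unfold quadSite
    congr 1
    exact tsum_congr fun z => by unfold bondQuad; rw [h y hyP z z.2.1]
  rw [hl, hq]

/-- … and the same `SmallStrain`. -/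
theorem smallStrain_congr_points {τ : ℝ} {X : Set E3} {β β' : E3 → E3 → E3} (h : ∀ y ∈ P.points, ∀ z ∈ P.points, β y z = β' y z)
    (hW : SmallStrain τ P X β) : SmallStrain τ P X β' :=
  fun y hy z hz hyX hzX => by rw [← h y hy z hz]; exact hW y hy z hz hyX hzX

/-- Conversely: an affine field plus a periodic-field cocycle is a global cocycle (it is the bond field of the equivariant displacement
`A + p`, `isGlobalCocycle_fieldCocycle_of_equivariant`). -/
theorem isGlobalCocycle_affine_add_fieldCocycle (A : E3 →ₗ[ℝ] E3) {p : E3 → E3} (hp : IsPeriodicField P p) :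
    IsGlobalCocycle P fun y z => affineField A y z + fieldCocycle p y z := by
  have e : (fun y z => affineField A y z + fieldCocycle p y z) = fieldCocycle fun q => A q + p q := by
    funext y z
    simp only [affineField_apply, fieldCocycle, map_sub]
    abel
  rw [e]
  exact isGlobalCocycle_fieldCocycle_of_equivariant ((isEquivariantField_linear A).add hp.isEquivariantField)

/-- **UNIQUENESS OF THE CHART, linear part**: the linear map of the chart is unique (it is read off the lattice bonds `β y₀ (y₀ + g) = A g`,
and a `ℤ`-basis of `Λ_P` spans `ℝ³`). -/
theorem affine_part_unique {β : E3 → E3 → E3} {A₁ A₂ : E3 →ₗ[ℝ] E3} {p₁ p₂ : E3 → E3} (hp₁ : IsPeriodicField P p₁)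
    (hp₂ : IsPeriodicField P p₂) (h₁ : ∀ y ∈ P.points, ∀ z ∈ P.points, β y z = affineField A₁ y z + fieldCocycle p₁ y z)
    (h₂ : ∀ y ∈ P.points, ∀ z ∈ P.points, β y z = affineField A₂ y z + fieldCocycle p₂ y z) : A₁ = A₂ := by
  obtain ⟨y₀, hy₀⟩ := P.points_nonempty
  have hΛ : ∀ g ∈ P.lattice, A₁ g = A₂ g := fun g hg => by
    have e₁ := h₁ y₀ hy₀ (y₀ + g) (P.add_mem_points hy₀ hg)
    have e₂ := h₂ y₀ hy₀ (y₀ + g) (P.add_mem_points hy₀ hg)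
    simp only [affineField_apply, fieldCocycle, add_sub_cancel_left, hp₁ g hg y₀, hp₂ g hg y₀, sub_self, add_zero] at e₁ e₂
    rw [← e₁, ← e₂]
  haveI := P.discrete
  haveI := P.isZLattice
  haveI : Module.Free ℤ P.lattice := ZLattice.module_free ℝ P.lattice
  let b := Module.Free.chooseBasis ℤ P.lattice
  let B : Module.Basis _ ℝ E3 := b.ofZLatticeBasis ℝ P.lattice
  refine B.ext fun i => ?_
  rw [Module.Basis.ofZLatticeBasis_apply]
  exact hΛ _ (b i).2

/-- **UNIQUENESS OF THE CHART, periodic part**: unique up to ONE additive constant on the reference points `F+Λ` (one class: every pair of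
reference points is a bond of the cocycle); off the reference it is arbitrary and never read. -/
theorem periodic_part_unique {β : E3 → E3 → E3} {A₁ A₂ : E3 →ₗ[ℝ] E3} {p₁ p₂ : E3 → E3} (hp₁ : IsPeriodicField P p₁)
    (hp₂ : IsPeriodicField P p₂) (h₁ : ∀ y ∈ P.points, ∀ z ∈ P.points, β y z = affineField A₁ y z + fieldCocycle p₁ y z)
    (h₂ : ∀ y ∈ P.points, ∀ z ∈ P.points, β y z = affineField A₂ y z + fieldCocycle p₂ y z) :
    ∀ y ∈ P.points, ∀ z ∈ P.points, p₁ z - p₁ y = p₂ z - p₂ y := by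
  have hA := affine_part_unique hp₁ hp₂ h₁ h₂
  intro y hy z hz
  have e₁ := h₁ y hy z hz
  have e₂ := h₂ y hy z hz
  simp only [affineField_apply, fieldCocycle, hA] at e₁ e₂
  exact add_left_cancel (e₁.symm.trans e₂)

end CocycleChart

end Summit.AtomisticToContinuum.Crystallization.Theorems.ChargedEnergyGapChartDial

end
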